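import Mathlib
import Literature.Barriers.MatrixMultiplication.NormalizerBarrier
import Literature.RepresentationTheory.FiniteGroups.CharacterDegrees
import Literature.RepresentationTheory.FiniteGroups.IrreducibleCharacters
import Literature.RepresentationTheory.FiniteGroups.BrauerInduction
import Literature.RepresentationTheory.FiniteGroups.MonomialRepresentation
import Summits.MatrixMultiplication.MatrixMultiplication.Theorems.LieRankDesigns.Negative.Basics
import Summits.MatrixMultiplication.MatrixMultiplication.Theorems.LevelGradedCohnUmansLieRankDesignsStubLevelOfFixedVector
import Summits.MatrixMultiplication.MatrixMultiplication.Theorems.SubgroupIdentityDesigns.Negative.BorelLevelOne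
import Summits.MatrixMultiplication.MatrixMultiplication.Theorems.SubgroupIdentityDesigns.Negative.BlockSliceTypes
import Summits.MatrixMultiplication.MatrixMultiplication.Theorems.SubgroupIdentityDesigns.Negative.BlockSliceNoGo
import Summits.MatrixMultiplication.MatrixMultiplication.Theorems.SubgroupIdentityDesigns.Negative.BlockSliceConditional
import Summits.MatrixMultiplication.MatrixMultiplication.Theorems.SubgroupIdentityDesigns.Negative.BlockSliceDesignOne
import Summits.MatrixMultiplication.MatrixMultiplication.Theorems.SubgroupIdentityDesigns.Negative.BlockSliceTranslate
import Summits.MatrixMultiplication.MatrixMultiplication.Theorems.SubgroupIdentityDesigns.Negative.LineStabilizer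
import Summits.MatrixMultiplication.MatrixMultiplication.Theorems.SubgroupIdentityDesigns.Negative.LineStabilizerCharacter
import Summits.MatrixMultiplication.MatrixMultiplication.Theorems.SubgroupIdentityDesigns.Negative.BlockSliceBudgetOne
import Summits.MatrixMultiplication.MatrixMultiplication.Theorems.SubgroupIdentityDesigns.Negative.PrincipalSeriesOne
import Summits.MatrixMultiplication.MatrixMultiplication.Theorems.SubgroupIdentityDesigns.Negative.PrincipalSeriesIrreducible

/-!
# The level-`1` budget of `GL_{1+l}(𝔽_p)` is `≥ (p-1) p^{ls}`; the `k = 1` no-go for ALL `l ≥ 1`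
# when `ε ≤ 1`

Supports stmt-MatrixMultiplication-14079 (route `LevelGradedCohnUmans`).  VALUE = theorem, NOT
    summit
progress.  `BlockSliceBudgetOne.no_slice_witness_one` /
    `BlockSliceTranslate.no_translate_witness_one`
settle the block slices `S_{1+l,1}` (and all their translates) for `l ≥ 3`, using the single
Steinberg-type character `Ind_P^G 1 − 1`.  Here the `p − 2` principal-series characters
`π_χ = Ind_P^G (χ ∘ a)`, `χ ≠ 1` (`PrincipalSeriesOne`, `PrincipalSeriesIrreducible`) are thrown in:

* `psChar_mem_levelSet` — `π_χ` has Fourier level `≤ 1` (fixed-line formula: a combination of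
  rank-one fibre indicators);
* `budget_ge` — for `l ≥ 1`, `s ≥ 0`:
  `∑ᶠ_{ψ ∈ Irr(GL_{1+l}(𝔽_p)) ∩ F_1} (ψ 1).re^s ≥ (p − 1) · (p^l)^s`
  (`Ind_P^G 1 − 1` and the `p − 2` characters `π_χ`, all of degree `≥ p^l`, pairwise distinct;
  `#{χ} = p − 1` by `MulChar.card_eq_card_units_of_hasEnoughRootsOfUnity`);
* `volume_le_one` — a subgroup-TPP triple with products in a conjugate of `S_{1+l,1}` has
  `|H₁||H₂||H₃| ≤ (p − 1) p^{3l}` (from `BlockSliceNoGo.volume_sq_le`: `V² ≤ (p-1)³ p^{5l}`);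
* `no_translate_witness_one_small` — **for every `l ≥ 1` (i.e. every `m = 1 + l ≥ 2`), every prime
  `p`, every `0 < ε ≤ 1` and every two-sided translate `x S_{1+l,1} y`, no subgroup-TPP triple with
  products in it satisfies the crux inequality** (`V^{s/3} ≤ (p-1)^{s/3} p^{ls} ≤ (p-1) p^{ls} ≤`
  budget for `s = 2 + ε ≤ 3`).  This removes the restriction `l ≥ 3` in the regime of small `ε`,
  which is the one the crux (`∀ ε > 0`) cares about.
-/

set_option linter.dupNamespace false

noncomputable section

open scoped BigOperators Matrix Classical
open Literature.Barriers.MatrixMultiplication (SubgroupTPP)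
open Literature.RepresentationTheory.FiniteGroups
open Summit.MatrixMultiplication.MatrixMultiplication.Theorems.LieRankDesigns.Negative
  (GLm Mat levelSet budget trivial_mem_levelSet character_trivial_apply re_apply_one_nonneg)
open Summit.MatrixMultiplication.MatrixMultiplication.Theorems.LieRankDesigns.LevelOfFixedVector
  (sum_mem_levelSet smul_mem_levelSet)

namespace Summit.MatrixMultiplication.MatrixMultiplication.Theorems.SubgroupIdentityDesigns.Negative
namespace PrincipalSeriesBudget

open LineStabilizer LineStabilizerCharacter PrincipalSeriesOne PrincipalSeriesIrreducible
open BlockSliceTypes (Dblk)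
open BlockSliceNoGo (volume_sq_le toSumHom Dblk_toSum)
open BlockSliceConditional (conjToSum conjToSum_injective)
open BlockSliceDesignOne (i0 fib fib_mem)
open BlockSliceBudgetOne (mulVec_ne_zero theta_mem_levelSet card_quotient_ge)
open BlockSliceTranslate (translate_to_conj_fin)

variable {p : ℕ} [hp : Fact p.Prime] {l : ℕ}


/-! ## Level, degree and irreducibility of `π_χ` over `𝔽_p` -/

/-- **`π_χ` has Fourier level `≤ 1`.** -/
theorem psChar_mem_levelSet (χ : MulChar (ZMod p) ℂ) : ((psChar (F := ZMod p) (i0 : Fin (1 + l))) χ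
    : (GLm p (1 + l)) → ℂ) ∈ levelSet p (1 + l) 1 := by
  have h : ((psChar (F := ZMod p) (i0 : Fin (1 + l))) χ : (GLm p (1 + l)) → ℂ) = fun y => ∑ q :
      (GLm p (1 + l) ⧸ lineStab (F := ZMod p) (i0 : Fin (1 + l))), ∑ b : ZMod p,
      χ b * fib (((q.out : (GLm p (1 + l))) : Mat p (1 + l)) *ᵥ Pi.single i0 1)
        (b • (((q.out : (GLm p (1 + l))) : Mat p (1 + l)) *ᵥ Pi.single i0 1)) y := by
    funext y
    rw [psChar_eq_sum]
    rfl
  rw [h]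
  exact sum_mem_levelSet _ _ fun q _ => sum_mem_levelSet _ _ fun b _ =>
    smul_mem_levelSet (fib_mem _ _) (χ b)

/-- `π_χ ∈ Irr ∩ F_1` for `χ ≠ 1`. -/
theorem psChar_mem {χ : MulChar (ZMod p) ℂ} (hχ : χ ≠ 1) :
    ((psChar (F := ZMod p) (i0 : Fin (1 + l))) χ : (GLm p (1 + l)) → ℂ) ∈ irrChars (GLm p (1 + l))
        ∩ levelSet p (1 + l) 1 :=
  ⟨isIrrChar_psChar _ hχ, psChar_mem_levelSet χ⟩

/-- `Ind_P^G 1 − 1 ∈ Irr ∩ F_1` (`l ≥ 1`). -/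
theorem steinberg_mem (hl : 1 ≤ l) : ((indClassFun (G := GLm p (1 + l)) (lineStab (F := ZMod p) (i0
    : Fin (1 + l))) (fun _ => (1 : ℂ))) - (Representation.character (Representation.trivial ℂ (GLm
    p (1 + l)) ℂ)) : (GLm p (1 + l)) → ℂ) ∈ irrChars (GLm p (1 + l)) ∩ levelSet p (1 + l) 1 := by
  have hn : 1 < 1 + l := by omega
  refine ⟨isIrrChar_theta_sub_triv (i0 : Fin (1 + l)) hn, ?_⟩
  have h := sub_mem_levelSet (theta_mem_levelSet (p := p) (l := l))
    (trivial_mem_levelSet (p := p) (m := 1 + l) 1).2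
  exact h

/-- `[G : P] ≥ p^l + 1` as reals. -/
theorem card_quotient_ge_real (hl : 1 ≤ l) : ((p : ℝ) ^ l) + 1 ≤ (Fintype.card (GLm p (1 + l) ⧸
    lineStab (F := ZMod p) (i0 : Fin (1 + l))) : ℝ) := by
  have h := card_quotient_ge (p := p) hl
  exact_mod_cast h

/-- The number of multiplicative characters of `𝔽_p` is `p − 1`. -/
theorem card_mulChar : Nat.card (MulChar (ZMod p) ℂ) = p - 1 := by
  rw [MulChar.card_eq_card_units_of_hasEnoughRootsOfUnity, Nat.card_eq_fintype_card,
      ZMod.card_units]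


/-! ## The budget -/

/-- **The level-`1` budget of `GL_{1+l}(𝔽_p)` is at least `(p − 1) (p^l)^s`** (`l ≥ 1`, `s ≥ 0`). -/
theorem budget_ge (hl : 1 ≤ l) {s : ℝ} (hs : 0 ≤ s) :
    ((p - 1 : ℕ) : ℝ) * ((p : ℝ) ^ l) ^ s ≤ budget p (1 + l) 1 s := by
  letI : Fintype (MulChar (ZMod p) ℂ) := Fintype.ofFinite _
  have hfin : (irrChars (GLm p (1 + l)) ∩ levelSet p (1 + l) 1).Finite :=
    (irrChars_finite_holds (GLm p (1 + l))).subset Set.inter_subset_left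
  have hcardQ := card_quotient_ge_real (p := p) hl
  -- the Steinberg-type character and the `p - 2` principal-series characters
  have hStT : ((indClassFun (G := GLm p (1 + l)) (lineStab (F := ZMod p) (i0 : Fin (1 + l))) (fun _
      => (1 : ℂ))) - (Representation.character (Representation.trivial ℂ (GLm p (1 + l)) ℂ)) : (GLm
      p (1 + l)) → ℂ) ∉
      (Finset.univ.erase (1 : MulChar (ZMod p) ℂ)).image (fun χ => ((psChar (F := ZMod p) (i0 : Fin
          (1 + l))) χ : (GLm p (1 + l)) → ℂ)) := by
    intro h
    obtain ⟨χ, _, hχ⟩ := Finset.mem_image.mp h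
    have h1 := congr_fun hχ 1
    rw [psChar_one, theta_sub_triv_one] at h1
    exact one_ne_zero (sub_eq_self.mp h1.symm)
  have hinj : Set.InjOn (fun χ : MulChar (ZMod p) ℂ => ((psChar (F := ZMod p) (i0 : Fin (1 + l))) χ
      : (GLm p (1 + l)) → ℂ))
      ↑(Finset.univ.erase (1 : MulChar (ZMod p) ℂ)) := by
    intro χ hχ χ' _ e
    by_contra hne
    exact psChar_ne (i0 : Fin (1 + l)) (Finset.ne_of_mem_erase (Finset.mem_coe.mp hχ)) hne e
  have hsub : insert ((indClassFun (G := GLm p (1 + l)) (lineStab (F := ZMod p) (i0 : Fin (1 + l)))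
      (fun _ => (1 : ℂ))) - (Representation.character (Representation.trivial ℂ (GLm p (1 + l)) ℂ))
      : (GLm p (1 + l)) → ℂ)
      ((Finset.univ.erase (1 : MulChar (ZMod p) ℂ)).image (fun χ => ((psChar (F := ZMod p) (i0 :
          Fin (1 + l))) χ : (GLm p (1 + l)) → ℂ))) ⊆
        hfin.toFinset := by
    intro ψ hψ
    rw [Set.Finite.mem_toFinset]
    rcases Finset.mem_insert.mp hψ with rfl | hψ
    · exact steinberg_mem hl
    · obtain ⟨χ, hχ, rfl⟩ := Finset.mem_image.mp hψ
      exact psChar_mem (Finset.ne_of_mem_erase hχ)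
  -- degrees
  have hdegSt : ((p : ℝ) ^ l) ^ s ≤ (((indClassFun (G := GLm p (1 + l)) (lineStab (F := ZMod p) (i0
      : Fin (1 + l))) (fun _ => (1 : ℂ))) - (Representation.character (Representation.trivial ℂ
      (GLm p (1 + l)) ℂ)) : (GLm p (1 + l)) → ℂ) 1).re ^ s := by
    refine Real.rpow_le_rpow (by positivity) ?_ hs
    rw [theta_sub_triv_one]
    simp only [Complex.sub_re, Complex.natCast_re, Complex.one_re]
    linarith
  have hdegPs : ∀ χ : MulChar (ZMod p) ℂ, ((p : ℝ) ^ l) ^ s ≤ (((psChar (F := ZMod p) (i0 : Fin (1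
      + l))) χ : (GLm p (1 + l)) → ℂ) 1).re ^ s := by
    intro χ
    refine Real.rpow_le_rpow (by positivity) ?_ hs
    rw [psChar_one]
    simp only [Complex.natCast_re]
    linarith
  -- count
  have hcount : (Finset.univ.erase (1 : MulChar (ZMod p) ℂ)).card = p - 2 := by
    rw [Finset.card_erase_of_mem (Finset.mem_univ _), Finset.card_univ, ← Nat.card_eq_fintype_card,
      card_mulChar]
    omega
  have hp1 : ((p - 1 : ℕ) : ℝ) = ((p - 2 : ℕ) : ℝ) + 1 := by
    have := hp.out.two_le
    norm_cast
    omega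
  calc ((p - 1 : ℕ) : ℝ) * ((p : ℝ) ^ l) ^ s
      = ((p : ℝ) ^ l) ^ s + ((p - 2 : ℕ) : ℝ) * ((p : ℝ) ^ l) ^ s := by rw [hp1]; ring
    _ ≤ (((indClassFun (G := GLm p (1 + l)) (lineStab (F := ZMod p) (i0 : Fin (1 + l))) (fun _ =>
        (1 : ℂ))) - (Representation.character (Representation.trivial ℂ (GLm p (1 + l)) ℂ)) : (GLm
        p (1 + l)) → ℂ) 1).re ^ s +
          ∑ ψ ∈ (Finset.univ.erase (1 : MulChar (ZMod p) ℂ)).image (fun χ => ((psChar (F := ZMod p)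
              (i0 : Fin (1 + l))) χ : (GLm p (1 + l)) → ℂ)),
            (ψ 1).re ^ s := by
        refine add_le_add hdegSt ?_
        rw [Finset.sum_image hinj]
        have h := Finset.card_nsmul_le_sum (Finset.univ.erase (1 : MulChar (ZMod p) ℂ))
          (fun χ => (((psChar (F := ZMod p) (i0 : Fin (1 + l))) χ : (GLm p (1 + l)) → ℂ) 1).re ^ s)
              _ (fun χ _ => hdegPs χ)
        rwa [hcount, nsmul_eq_mul] at h
    _ = ∑ ψ ∈ insert ((indClassFun (G := GLm p (1 + l)) (lineStab (F := ZMod p) (i0 : Fin (1 + l)))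
        (fun _ => (1 : ℂ))) - (Representation.character (Representation.trivial ℂ (GLm p (1 + l))
        ℂ)) : (GLm p (1 + l)) → ℂ)
          ((Finset.univ.erase (1 : MulChar (ZMod p) ℂ)).image (fun χ => ((psChar (F := ZMod p) (i0
              : Fin (1 + l))) χ : (GLm p (1 + l)) → ℂ))),
            (ψ 1).re ^ s := (Finset.sum_insert (f := fun ψ : (GLm p (1 + l)) → ℂ => (ψ 1).re ^ s)
                hStT).symm
    _ ≤ budget p (1 + l) 1 s := by
        unfold budget
        rw [finsum_mem_eq_finite_toFinset_sum _ hfin]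
        exact Finset.sum_le_sum_of_subset_of_nonneg hsub fun ψ hψ _ =>
          Real.rpow_nonneg (re_apply_one_nonneg (hfin.mem_toFinset.mp hψ).1) s

/-! ## The volume of a slice triple, `k = 1` -/

/-- `|GL_1(𝔽_p)| = p − 1`. -/
theorem card_GL_one : Nat.card (GL (Fin 1) (ZMod p)) = p - 1 := by
  rw [Matrix.card_GL_field, Fin.prod_univ_one, ZMod.card]
  simp

/-- **`V ≤ (p − 1) p^{3l}`** for a subgroup-TPP triple of `GL_{1+l}(𝔽_p)` whose triple products lie
    in
a conjugate `x S_{1+l,1} x⁻¹` of the block slice (`l ≥ 1`). -/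
theorem volume_le_one (hl : 1 ≤ l) {H₁ H₂ H₃ : Subgroup (GL (Fin (1 + l)) (ZMod p))}
    (htpp : SubgroupTPP H₁ H₂ H₃) (x : GL (Fin (1 + l)) (ZMod p))
    (hS : ∀ a ∈ H₁, ∀ b ∈ H₂, ∀ c ∈ H₃, ∀ i j : Fin l,
      ((x⁻¹ * (a * b * c) * x : GL (Fin (1 + l)) (ZMod p)) :
        Matrix (Fin (1 + l)) (Fin (1 + l)) (ZMod p)) (Fin.natAdd 1 i) (Fin.natAdd 1 j) =
          (1 : Matrix (Fin l) (Fin l) (ZMod p)) i j) :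
    Nat.card H₁ * Nat.card H₂ * Nat.card H₃ ≤ (p - 1) * p ^ (3 * l) := by
  have hφ : Function.Injective (conjToSum (F := ZMod p) (k := 1) (l := l) x) :=
    conjToSum_injective x
  have htpp' : SubgroupTPP (H₁.map (conjToSum x)) (H₂.map (conjToSum x))
      (H₃.map (conjToSum (k := 1) (l := l) x)) := by
    rintro _ ⟨a, ha, rfl⟩ _ ⟨b, hb, rfl⟩ _ ⟨c, hc, rfl⟩ h
    rw [← map_mul, ← map_mul, map_eq_one_iff _ hφ] at h
    obtain ⟨h1, h2, h3⟩ := htpp a ha b hb c hc h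
    exact ⟨by rw [h1, map_one], by rw [h2, map_one], by rw [h3, map_one]⟩
  have hS' : ∀ a ∈ H₁.map (conjToSum x), ∀ b ∈ H₂.map (conjToSum x),
      ∀ c ∈ H₃.map (conjToSum (k := 1) (l := l) x), Dblk (a * b * c) = 1 := by
    rintro _ ⟨a, ha, rfl⟩ _ ⟨b, hb, rfl⟩ _ ⟨c, hc, rfl⟩
    rw [← map_mul, ← map_mul]
    ext i j
    show Dblk (toSumHom ((MulAut.conj x⁻¹) (a * b * c))) i j = _
    rw [Dblk_toSum, MulAut.conj_apply, inv_inv]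
    exact hS a ha b hb c hc i j
  have h := volume_sq_le (F := ZMod p) htpp' hS'
  rw [Subgroup.card_map_of_injective hφ, Subgroup.card_map_of_injective hφ,
    Subgroup.card_map_of_injective hφ, Nat.card_zmod, card_GL_one] at h
  -- `V² ≤ (p-1)³ p^{5l} ≤ ((p-1) p^{3l})²` since `p - 1 ≤ p^l`
  have hpl : p - 1 ≤ p ^ l := (Nat.sub_le p 1).trans (Nat.le_self_pow (by omega) p)
  have h2 : (p - 1) ^ 3 * p ^ (5 * 1 * l) ≤ ((p - 1) * p ^ (3 * l)) ^ 2 := by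
    have e1 : (p - 1) ^ 3 * p ^ (5 * 1 * l) = (p - 1) ^ 2 * p ^ (5 * l) * (p - 1) := by ring
    have e2 : ((p - 1) * p ^ (3 * l)) ^ 2 = (p - 1) ^ 2 * p ^ (5 * l) * p ^ l := by ring
    rw [e1, e2]
    exact Nat.mul_le_mul_left _ hpl
  exact (Nat.pow_le_pow_iff_left two_ne_zero).mp (h.trans h2)

/-! ## The no-go for all `l ≥ 1`, `0 < ε ≤ 1` -/

/-- **No-go on every translate of `S_{1+l,1}`, all `l ≥ 1`, `0 < ε ≤ 1` (UNCONDITIONAL).**  For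
    every
prime `p`, every `l ≥ 1`, every `ε ∈ (0, 1]`, every subgroup-TPP triple `H₁, H₂, H₃ ≤ GL_{1+l}(𝔽_p)`
whose product set lies in a two-sided translate `x S_{1+l,1} y` of the block slice (lower-right
`l × l` block of `x⁻¹ (abc) y⁻¹` equal to `1`) VIOLATES the crux inequality
`∑ᶠ_{ψ ∈ Irr ∩ F_1} (ψ 1).re^{2+ε} < (|H₁||H₂||H₃|)^{(2+ε)/3}`. -/
theorem no_translate_witness_one_small (hl : 1 ≤ l) {H₁ H₂ H₃ : Subgroup (GLm p (1 + l))}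
    (htpp : SubgroupTPP H₁ H₂ H₃) (x y : GLm p (1 + l))
    (hS : ∀ a ∈ H₁, ∀ b ∈ H₂, ∀ c ∈ H₃, ∀ i j : Fin l,
      ((x⁻¹ * (a * b * c) * y⁻¹ : GLm p (1 + l)) : Mat p (1 + l)) (Fin.natAdd 1 i) (Fin.natAdd 1 j)
          =
        (1 : Matrix (Fin l) (Fin l) (ZMod p)) i j)
    {ε : ℝ} (hε : 0 < ε) (hε1 : ε ≤ 1) :
    ¬ ((∑ᶠ ψ ∈ irrChars (GLm p (1 + l)) ∩ levelSet p (1 + l) 1, (ψ 1).re ^ (2 + ε)) <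
        ((Nat.card H₁ * Nat.card H₂ * Nat.card H₃ : ℕ) : ℝ) ^ ((2 + ε) / 3)) := by
  have h1 := hS 1 H₁.one_mem 1 H₂.one_mem 1 H₃.one_mem
  simp only [mul_one] at h1
  obtain ⟨z, hz⟩ := translate_to_conj_fin x y h1
  have hV := volume_le_one hl htpp z (fun a ha b hb c hc => hz _ (hS a ha b hb c hc))
  have hB := budget_ge (p := p) hl (s := 2 + ε) (by linarith)
  show ¬ (budget p (1 + l) 1 (2 + ε) < _)
  intro hlt
  have hp1 : (1 : ℝ) ≤ ((p - 1 : ℕ) : ℝ) := by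
    have := hp.out.two_le
    exact_mod_cast (show 1 ≤ p - 1 by omega)
  have hP0 : (0 : ℝ) ≤ (p : ℝ) ^ l := by positivity
  -- `V^{s/3} ≤ ((p-1) p^{3l})^{s/3} = (p-1)^{s/3} (p^l)^s ≤ (p-1) (p^l)^s ≤ budget`
  have hV' : ((Nat.card H₁ * Nat.card H₂ * Nat.card H₃ : ℕ) : ℝ) ≤
      ((p - 1 : ℕ) : ℝ) * ((p : ℝ) ^ l) ^ 3 := by
    have e : ((p : ℝ) ^ l) ^ 3 = ((p ^ (3 * l) : ℕ) : ℝ) := by push_cast; ring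
    rw [e]
    exact_mod_cast hV
  have step1 : ((Nat.card H₁ * Nat.card H₂ * Nat.card H₃ : ℕ) : ℝ) ^ ((2 + ε) / 3) ≤
      ((p - 1 : ℕ) : ℝ) ^ ((2 + ε) / 3) * ((p : ℝ) ^ l) ^ (2 + ε) := by
    have e : ((p : ℝ) ^ l) ^ (2 + ε) = (((p : ℝ) ^ l) ^ 3) ^ ((2 + ε) / 3) := by
      rw [← Real.rpow_natCast ((p : ℝ) ^ l) 3, ← Real.rpow_mul hP0]
      congr 1
      push_cast
      ring
    rw [e, ← Real.mul_rpow (by positivity) (by positivity)]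
    exact Real.rpow_le_rpow (Nat.cast_nonneg _) hV' (by positivity)
  have step2 : ((p - 1 : ℕ) : ℝ) ^ ((2 + ε) / 3) ≤ ((p - 1 : ℕ) : ℝ) := by
    conv_rhs => rw [← Real.rpow_one ((p - 1 : ℕ) : ℝ)]
    exact Real.rpow_le_rpow_of_exponent_le hp1 (by linarith)
  have step3 : ((p - 1 : ℕ) : ℝ) ^ ((2 + ε) / 3) * ((p : ℝ) ^ l) ^ (2 + ε) ≤
      ((p - 1 : ℕ) : ℝ) * ((p : ℝ) ^ l) ^ (2 + ε) :=
    mul_le_mul_of_nonneg_right step2 (by positivity)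
  linarith

end PrincipalSeriesBudget
end Summit.MatrixMultiplication.MatrixMultiplication.Theorems.SubgroupIdentityDesigns.Negative
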